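import Literature.AlgebraicGeometry.HodgeTheory.CorrespondenceActionHodgeClassesOfGysinResolved
import Literature.AlgebraicGeometry.Resolution.ProjectiveResolutionProofs
import Literature.AlgebraicGeometry.HodgeTheory.SupportedClassesPurity
import Literature.AlgebraicGeometry.HodgeTheory.SupportedClassesIrreducible
import Literature.AlgebraicGeometry.HodgeTheory.ComplexGysinHodgeType
import Literature.AlgebraicGeometry.HodgeTheory.SupportedHodgeClassDescent
import Literature.AlgebraicGeometry.HodgeTheory.GysinFormalismHodgeOfGysin
import Literature.AlgebraicGeometry.HodgeTheory.GysinKernelProofs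
import Literature.AlgebraicGeometry.HodgeTheory.HodgeFiltrationModelsReductionProofs
import Literature.AlgebraicGeometry.HodgeTheory.ComplexConjugationHolds
import Literature.AlgebraicGeometry.HodgeTheory.HodgeTypeConjugation
import Literature.AlgebraicTopology.SingularHomology.GysinMapSupportProofs
import Literature.NumberTheory.Transcendental.DeRhamTheoremMultiplicative
import HarnessLib

/-!
# Algebraic classes are Hodge classes: `Nᵏ H²ᵏ(Y(ℂ); ℂ)` consists of classes of type `(k, k)` (Voisin I, Prop. 11.20), from the non-vanishing of fundamental classes

Family `hodge`, layer `Literature/AlgebraicGeometry/HodgeTheory`. C. Voisin, *Hodge Theory and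
Complex Algebraic Geometry I* (2002), §11.1.3 Prop. 11.20: "The image in `H^{2r}(X, ℂ)` of the class
`[Z] ∈ H^{2r}(X, ℤ)` lies in `H^{r,r}(X)`" — the class of an algebraic cycle is a Hodge class. On the
summit carriers the space of algebraic classes is `algebraicClasses Y k = Nᵏ H²ᵏ(Y(ℂ); ℂ)` (classes
dying off a Zariski-closed subset of codimension `≥ k`, file `AlgebraicClasses`), so the statement to
prove is: for `Y` smooth projective of dimension `n`, every `x ∈ algebraicClasses Y k` is
`IsOfHodgeType n Y (2k) k k x`. This is the PURE CASE `s = k`, degree `2k`, of Grothendieck's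
coniveau inclusion (named fact `Grothendieck1969_supportedClasses_le_hodgeConiveau`, file
`SupportedClassesHodgeConiveau`; also a consequence of Deligne's Cor. 8.2.8,
`Deligne1974_ker_restrictCompl_eq_iSup_range_complexGysin`, whose open input is mixed Hodge theory).

This file PROVES the pure case from a single, Hodge-theory-free, classical input, recorded as the
named fact (D-0014)

* `map_fundamentalClass_ne_zero_of_height_eq` — **the fundamental class of a subvariety is not
  homologous to zero**, in push-forward form: for `τ : V ⟶ Y` between smooth projective varieties,
  generically finite onto its image (`dim τ(V) = dim V = d`), `τ(ℂ)_* [V(ℂ)] ≠ 0` in `H_{2d}(Y(ℂ); ℂ)`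
  (Fulton, Lemma 19.1.2: `τ_* [V] = deg(V/τ(V)) [τ(V)]`; Griffiths–Harris, Ch. 0 §7: the class of a
  `d`-dimensional analytic subvariety of a compact Kähler manifold is non-zero, pairing to
  `d! · vol > 0` with `[ω]^d` by the Wirtinger theorem, Ch. 0 §2),

assembling the tree's THEOREMS for everything else in the printed proofs (Fulton §19.1 Lemma 19.1.1
"`H²ᵏ(X, X − V)` is freely generated by the class of `V`"; Voisin I §11.1.2–11.1.4, §7.3.2):

* `algebraicClasses_eq_iSup_coheight_genericPoint_eq` (`SupportedClassesIrreducible`) — `Nᵏ H²ᵏ` is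
  the sum over the irreducible closed `Z` of codimension exactly `k` of `ker (H²ᵏ(Y) → H²ᵏ(Y ∖ Z))`;
* `exists_ker_restrictCompl_le_span_of_isIrreducible` (`SupportedClassesPurity`) — each such kernel is
  at most a line (purity);
* projective Hironaka `Resolution.Hironaka1964_projective_holds` (`exists_resolution_base_eq`: a
  resolution `τ : V ⟶ Y` of `Z`, `V` smooth projective of dimension `dim Z`);
* the Gysin morphism `τ_* = complexGysin μ` with its support property
  (`complexGysin_restrictCompl_eq_zero`, fed the theorem `gysinMap_restrictCompl_eq_zero_of_field ℂ`:
  `τ_* 1` dies off `Z ⊇ τ(V)`), its bidegree `(k, k)` on Hodge types (`isOfHodgeType_complexGysin`, fed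
  the theorems `hodgePQ_independent_of_hodgeModel_holds`, `nonempty_hodgeModel_holds`,
  `exists_deRhamIsoFamily_holds`) and `τ_* 1 ⌢ [Y(ℂ)] = τ(ℂ)_*[V(ℂ)]` (`capProduct_complexGysin_one`,
  Poincaré duality `OrientationFamily.hasPoincareDuality`).

Results: `map_fundamentalClass_ne_zero_of_height_eq.complexGysin_one_ne_zero` (`τ_* 1 ≠ 0`),
`exists_resolution_base_eq`, `isOfHodgeType_of_restrictCompl_eq_zero_of_isIrreducible` (classes dying
off ONE irreducible `Z` of codimension `k` are of type `(k,k)`: the kernel is `ℂ · τ_* 1`), and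
`isOfHodgeType_of_mem_algebraicClasses` — **Voisin I Prop. 11.20 on the summit carriers, granted the
fact.** Consumer: the route item `OrthogonalSplit` of
`Summits/HodgeConjecture/HodgeConjecture/Theses/EndoscopicMiddleDegree`
(`Theorems/EndoscopicMiddleDegreeOrthogonalSplitOfFacts.orthogonalSplit_of_algebraicClasses_isOfHodgeType`),
whose residue thereby becomes this one fact.

Not here: the discharge of the fact (the Wirtinger inequality for the pulled-back Fubini–Study form
`θ_{τ ≫ ι}` of a generically immersive `τ`, `∫_{V^an} θ^d_{τ≫ι} > 0`, and its transport to the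
Kronecker pairing with `[V(ℂ)]`).

## References

* [VoisinHodgeI2002] C. Voisin, Hodge Theory and Complex Algebraic Geometry I (CUP 2002), §7.3.2,
  §11.1.2 (Lemma 11.13, cohomology class), §11.1.3 Prop. 11.20, §11.1.4.
* [Fulton1998] W. Fulton, Intersection Theory, 2nd ed. (Springer 1998), §19.1 Lemma 19.1.1,
  Lemma 19.1.2.
* [GriffithsHarrisPrinciples1978] P. Griffiths, J. Harris, Principles of Algebraic Geometry (Wiley
  1978), Ch. 0 §2 p. 31 (Wirtinger theorem), Ch. 0 §7 pp. 109–111.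
* [Kollar2007] J. Kollár, Lectures on Resolution of Singularities (2007), Thm. 3.27.
* [GrothendieckTopology1969] A. Grothendieck, Hodge's general conjecture is false for trivial
  reasons, Topology 8 (1969), p. 299 (∗).
-/

noncomputable section

open scoped Manifold
open CategoryTheory AlgebraicGeometry
open Literature.AlgebraicTopology.SingularHomology

namespace Literature.AlgebraicGeometry.HodgeTheory

section HodgeTheory

/-- **The fundamental class of a subvariety of a smooth projective complex variety is not
homologous to zero** (named fact, D-0014), in push-forward form. For `Y` smooth projective of
dimension `n`, `V` smooth projective of dimension `d` and a morphism `τ : V ⟶ Y` which is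
generically finite onto its image — the image `τ(η)` of the generic point `η` of `V` has dimension
(`Order.height`) `d`, i.e. `dim τ(V) = dim V` — the image of the fundamental class of the closed
oriented `2d`-manifold `V(ℂ)` (any orientation family `μ`) is non-zero:
`τ(ℂ)_* [V(ℂ)] ≠ 0` in `H_{2d}(Y(ℂ); ℂ)`. In print: `τ_*[V] = deg(V/τ(V)) · [τ(V)]` (Fulton,
Lemma 19.1.2) and the fundamental class of a `d`-dimensional closed analytic subvariety `W` of a
compact Kähler manifold is non-zero, its pairing with `[ω]^d` being `d! · vol(W) > 0` by the Wirtinger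
theorem (Griffiths–Harris, Ch. 0 §7 with Ch. 0 §2). The tree has neither the fundamental class of a
singular subvariety nor the Wirtinger theorem on the summit carriers; this statement, through a
resolution `τ`, is the exact input needed to identify `ker (H²ᵏ(Y) → H²ᵏ(Y ∖ W))` with `ℂ · τ_* 1`
(below). [cite: GriffithsHarrisPrinciples1978, Ch. 0 §7 pp. 109–111 and Ch. 0 §2 p. 31 (Wirtinger theorem)]
[cite: Fulton1998, §19.1 Lemma 19.1.2] -/
def map_fundamentalClass_ne_zero_of_height_eq : Prop :=
  ∀ (μ : OrientationFamily) ⦃n : ℕ⦄ ⦃Y : Motives.SchemeOver ℂ⦄ (_ : Motives.IsSmoothProjective n Y)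
    ⦃d : ℕ⦄ ⦃V : Motives.SchemeOver ℂ⦄ (hV : Motives.IsSmoothProjective d V) (τ : V ⟶ Y) (η : V.left),
    IsGenericPoint η Set.univ → Order.height (τ.left.base η) = d →
    singularHomology.map ℂ ℂ (Motives.AlgPoints.mapContinuous (L := ℂ) τ) (2 * d)
      (μ hV).fundamentalClass ≠ 0

variable {n : ℕ} {Y : Motives.SchemeOver ℂ}

namespace map_fundamentalClass_ne_zero_of_height_eq

/-- **Cohomological form: `τ_* 1_V ≠ 0`** in `H^{2e}(Y(ℂ); ℂ)` (`d + e = n`) for `τ : V ⟶ Y`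
generically finite onto its image — `τ_* 1 ⌢ [Y(ℂ)] = τ(ℂ)_* [V(ℂ)]` (`capProduct_complexGysin_one`).
[cite: FultonYoungTableaux1997, Appendix B §B.1 (5)] [cite: Fulton1998, §19.1 Lemma 19.1.2] -/
theorem complexGysin_one_ne_zero (h : map_fundamentalClass_ne_zero_of_height_eq) (μ : OrientationFamily)
    (hY : Motives.IsSmoothProjective n Y) {d : ℕ} {V : Motives.SchemeOver ℂ}
    (hV : Motives.IsSmoothProjective d V) (τ : V ⟶ Y) {η : V.left} (hη : IsGenericPoint η Set.univ)
    (hd : Order.height (τ.left.base η) = d) {e : ℕ} (hde : d + e = n) :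
    complexGysin μ hV hY τ (show 0 + 2 * n = 2 * e + 2 * d by omega)
      (singularCohomology.one ℂ (Motives.ComplexPoints V)) ≠ 0 := by
  intro h0
  have h1 := capProduct_complexGysin_one (OrientationFamily.hasPoincareDuality μ) hV hY τ hde
  rw [h0, LinearMap.map_zero, LinearMap.zero_apply] at h1
  exact h μ hY hV τ η hη hd h1.symm

end map_fundamentalClass_ne_zero_of_height_eq

/-! ### A resolution of the closure of a point -/

/-- **Resolving the closure of a point** (projective Hironaka, a theorem of the tree:
`Resolution.Hironaka1964_projective_holds`, Kollár Thm. 3.27): for a point `z` of a smooth projective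
`Y` with `dim closure {z} = d` there is a morphism `τ : V ⟶ Y` from a smooth projective `V` of
dimension `d` mapping the generic point of `V` to `z` (a resolution of `closure {z}` followed by the
closed immersion; cf. `exists_resolution_primeCycle`). [cite: Kollar2007, Thm. 3.27] -/
theorem exists_resolution_base_eq (hY : Motives.IsSmoothProjective n Y) (z : Y.left) {d : ℕ}
    (hzd : Order.height z = d) :
    ∃ (V : Motives.SchemeOver ℂ) (τ : V ⟶ Y) (η : V.left), Motives.IsSmoothProjective d V ∧
      IsGenericPoint η Set.univ ∧ τ.left.base η = z := by
  set X₀ := Motives.ClosedSubvariety.ofPoint Y.left z with hX₀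
  obtain ⟨d', V, π, hV, hπ, hdim⟩ :=
    exists_resolution_ofPoint Resolution.Hironaka1964_projective_holds hY z
  obtain rfl : d' = d := by
    rw [hzd] at hdim
    exact_mod_cast hdim.symm
  haveI : IsIntegral X₀.toSchemeOver.left := inferInstanceAs (IsIntegral X₀.carrier)
  haveI : IsIntegral V.left := Motives.IsSmoothProjective.isIntegral_holds hV
  refine ⟨V, π ≫ X₀.ιOver, genericPoint V.left, hV, genericPoint_spec V.left, ?_⟩
  rw [Over.comp_left, Scheme.Hom.comp_base, TopCat.comp_app, base_genericPoint_of_isBirational hπ]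
  exact Motives.ClosedSubvariety.genericPoint_ofPoint z

/-! ### Classes dying off one irreducible subvariety -/

/-- **The classes of `H²ᵏ(Y(ℂ); ℂ)` dying off an irreducible closed `Z` of codimension `k` are of Hodge
type `(k, k)`**, granted `map_fundamentalClass_ne_zero_of_height_eq`. Proof: for `k = 0` every class
of `H⁰` is of type `(0,0)`; for `k ≥ 1` let `τ : V ⟶ Y` resolve `Z` (`exists_resolution_base_eq`); the
class `y₀ = τ_* 1_V` dies off `Z` (support property of Gysin maps, `complexGysin_restrictCompl_eq_zero`),
is of type `(k, k)` (`τ_*` has bidegree `(k, k)`, `isOfHodgeType_complexGysin`, `1_V` being of type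
`(0,0)`) and is NON-ZERO (the fact); since the kernel is at most a line (purity,
`exists_ker_restrictCompl_le_span_of_isIrreducible`), it is `ℂ · y₀`. In print: `H²ᵏ(Y, Y − Z)` is free
of rank one on the class of `Z` (Fulton, Lemma 19.1.1) and that class is `τ_*(1)`, a Hodge class
(Voisin I §11.1.4, Prop. 11.20 via §7.3.2). [cite: VoisinHodgeI2002, §11.1.2 Prop. 11.20, §11.1.4 and §7.3.2]
[cite: Fulton1998, §19.1 Lemma 19.1.1 and Lemma 19.1.2] -/
theorem isOfHodgeType_of_restrictCompl_eq_zero_of_isIrreducible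
    (h : map_fundamentalClass_ne_zero_of_height_eq) (hY : Motives.IsSmoothProjective n Y)
    {Z : Set Y.left} (hZ : IsClosed Z) (hZi : IsIrreducible Z) {k : ℕ}
    (hk : Order.coheight hZi.genericPoint = k) (hcZ : ∀ z ∈ Z, (k : ℕ∞) ≤ Order.coheight z)
    {x : complexBetti Y (2 * k)} (hx : complexBetti.restrictCompl Y Z (2 * k) x = 0) :
    IsOfHodgeType n Y (2 * k) k k x := by
  obtain ⟨A⟩ := (nonempty_hodgeModel_holds (n := n) (X := Y)).nonempty hY
  rcases Nat.eq_zero_or_pos k with rfl | hk1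
  · exact isOfHodgeType_zero_zero_zero A x
  -- dimension and codimension of `Z = closure {z}`
  set z := hZi.genericPoint with hzdef
  have hzZ : z ∈ Z := (hZi.isGenericPoint_genericPoint hZ).mem
  obtain ⟨d, c, hzd, hzc, hdc⟩ := exists_height_eq_coheight_eq hY z
  obtain rfl : c = k := by
    rw [hzc] at hk
    exact_mod_cast hk
  -- a resolution `τ : V ⟶ Y` of `Z`
  obtain ⟨V, τ, η, hV, hη, hτη⟩ := exists_resolution_base_eq hY z hzd
  -- the orientation family of the complex orientations and its Gysin image of `1`
  let μ : OrientationFamily := fun _ _ hW ↦ (Motives.ComplexPoints.isOrientableOver ℂ hW).some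
  have hμ : μ.HasPoincareDuality := OrientationFamily.hasPoincareDuality μ
  set y₀ : complexBetti Y (2 * c) := complexGysin μ hV hY τ (show 0 + 2 * n = 2 * c + 2 * d by omega)
    (singularCohomology.one ℂ (Motives.ComplexPoints V)) with hy₀def
  -- `y₀ ≠ 0` (the fact)
  have hy0 : y₀ ≠ 0 :=
    h.complexGysin_one_ne_zero μ hY hV τ hη (by rw [hτη]; exact hzd) hdc
  -- `y₀` dies off `Z`: `τ(V) ⊆ Z`
  have hpre : τ.left.base ⁻¹' Z = Set.univ := by
    refine Set.eq_univ_of_forall fun v ↦ ?_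
    have hgen' := hη.image τ.left.continuous
    rw [Set.image_univ, hτη] at hgen'
    have h1 : τ.left.base v ∈ closure (Set.range τ.left.base) := subset_closure ⟨v, rfl⟩
    rw [← hgen'.def] at h1
    exact closure_minimal (Set.singleton_subset_iff.2 hzZ) hZ h1
  have hy₀ker : complexBetti.restrictCompl Y Z (2 * c) y₀ = 0 := by
    refine complexGysin_restrictCompl_eq_zero (gysinMap_restrictCompl_eq_zero_of_field ℂ) μ hμ hV hY τ
      _ hZ _ ?_
    haveI : IsEmpty (Motives.complexPointsCompl V (τ.left.base ⁻¹' Z)) :=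
      ⟨fun P ↦ P.2 (Set.eq_univ_iff_forall.1 hpre _)⟩
    haveI := ModuleCat.subsingleton_of_isZero
      (Motives.isZero_singularCohomology_of_isEmpty ℂ ℂ
        (E := Motives.complexPointsCompl V (τ.left.base ⁻¹' Z)) 0)
    exact Subsingleton.elim _ _
  -- `y₀` is of type `(c, c)`
  have hy₀T : IsOfHodgeType n Y (2 * c) c c y₀ := by
    obtain ⟨B⟩ := (nonempty_hodgeModel_holds (n := d) (X := V)).nonempty hV
    exact isOfHodgeType_complexGysin hodgePQ_independent_of_hodgeModel_holds
      (fun _ _ ↦ nonempty_hodgeModel_holds)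
      (fun E _ _ _ ↦ Literature.NumberTheory.Transcendental.exists_deRhamIsoFamily_holds E) μ hV hY τ _
      (p := 0) (q := 0) (by omega) (by omega) (isOfHodgeType_zero_zero_zero B _)
  -- purity: the kernel is at most a line, hence `= ℂ · y₀`
  obtain ⟨t, ht⟩ := exists_ker_restrictCompl_le_span_of_isIrreducible hY hZ hZi hk1 hcZ
  obtain ⟨a, ha⟩ := Submodule.mem_span_singleton.1 (ht (LinearMap.mem_ker.2 hy₀ker))
  obtain ⟨b, hb⟩ := Submodule.mem_span_singleton.1 (ht (LinearMap.mem_ker.2 hx))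
  have ha0 : a ≠ 0 := by
    rintro rfl
    rw [zero_smul] at ha
    exact hy0 ha.symm
  have hxy : x = (b / a) • y₀ := by
    rw [← hb, ← ha, smul_smul, div_mul_cancel₀ b ha0]
  rw [hxy]
  exact IsOfHodgeType.smul hy₀T _

/-! ### Algebraic classes are Hodge classes -/

/-- **Algebraic classes are Hodge classes** (Voisin I, Prop. 11.20: "the image in `H^{2r}(X, ℂ)` of the
class `[Z] ∈ H^{2r}(X, ℤ)` lies in `H^{r,r}(X)`"), on the summit carriers and granted the named fact
`map_fundamentalClass_ne_zero_of_height_eq`: for `Y` smooth projective of dimension `n`, every class of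
`algebraicClasses Y k = Nᵏ H²ᵏ(Y(ℂ); ℂ)` is of Hodge type `(k, k)`. The space is the sum over the
irreducible closed `Z` of codimension exactly `k` of the classes dying off `Z`
(`algebraicClasses_eq_iSup_coheight_genericPoint_eq`), each of which is of type `(k,k)`
(`isOfHodgeType_of_restrictCompl_eq_zero_of_isIrreducible`), and the classes of type `(k,k)` form a
subspace (read in one Hodge model, `hodgePQ_independent_of_hodgeModel_holds`). This is the pure case
`s = k`, degree `2k`, of Grothendieck's coniveau inclusion `Grothendieck1969_supportedClasses_le_hodgeConiveau`.
[cite: VoisinHodgeI2002, §11.1.2 Prop. 11.20] [cite: GrothendieckTopology1969, p. 299 (∗)] -/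
theorem isOfHodgeType_of_mem_algebraicClasses (h : map_fundamentalClass_ne_zero_of_height_eq)
    (hY : Motives.IsSmoothProjective n Y) (k : ℕ) {x : complexBetti Y (2 * k)}
    (hx : x ∈ algebraicClasses Y k) : IsOfHodgeType n Y (2 * k) k k x := by
  obtain ⟨A⟩ := (nonempty_hodgeModel_holds (n := n) (X := Y)).nonempty hY
  have hI := hodgePQ_independent_of_hodgeModel_holds
  rw [algebraicClasses_eq_iSup_coheight_genericPoint_eq hY k] at hx
  rw [hI.isOfHodgeType_iff hY A]
  let S : Submodule ℂ (complexBetti Y (2 * k)) := (A.hodgePQ (2 * k) k k).comap (A.pullback (2 * k)).hom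
  change x ∈ S
  suffices hle : (⨆ (Z : Set Y.left) (_ : IsClosed Z) (hZi : IsIrreducible Z)
      (_ : ∀ v ∈ Z, (k : ℕ∞) ≤ Order.coheight v) (_ : Order.coheight hZi.genericPoint = k),
      LinearMap.ker (complexBetti.restrictCompl Y Z (2 * k)).hom) ≤ S from hle hx
  refine iSup_le fun Z ↦ iSup_le fun hZ ↦ iSup_le fun hZi ↦ iSup_le fun hcZ ↦ iSup_le fun hk ↦ ?_
  intro y hy
  change A.pullback (2 * k) y ∈ A.hodgePQ (2 * k) k k
  rw [← hI.isOfHodgeType_iff hY A]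
  exact isOfHodgeType_of_restrictCompl_eq_zero_of_isIrreducible h hY hZ hZi hk hcZ (LinearMap.mem_ker.1 hy)

end HodgeTheory

end Literature.AlgebraicGeometry.HodgeTheory

end
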